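import Mathlib

/-!
# Lexicographic products of ladders are ladders — explicit / elementary proof (support file)

Item `stmt-MatrixMultiplication-14308` (`FourierTwoFamiliesModP.PrimeTwoFamilies`, CKSU 2005 Conj. 4.7
with prime cyclic hosts), line `Sketch`, registered stub `isLadder_lexProd` (siege k22, variation
"explicit / elementary route").  Independent proofs of the same registered statement live in the
namespaces `…Theorems.PrimeTwoFamilies.LadderLift` and `…Theorems.PrimeTwoFamilies.LadderLexProdFiniteCore`;
this file is self-contained (imports only Mathlib) and declares in its own namespace.

A LADDER in an additive commutative group `G` is an ordered family `(X c, Y c)_{c < r}` of finite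
subsets with

* (directness, `hW`) `(x - x') + (y - y') = 0 → x = x' ∧ y = y'` for `x, x' ∈ X c`, `y, y' ∈ Y c`;
* (one-directional separation, `hL`) for `p < q` no lower cross difference `y' - x'`
  (`x' ∈ X p`, `y' ∈ Y q`) equals a diagonal difference `y - x` (`x ∈ X c`, `y ∈ Y c`).

`isLadder_lexProd`: from a ladder indexed by `Fin r₁` in `G₁` and one indexed by `Fin r₂` in `G₂`,
the `Fin (r₁ * r₂)`-indexed family `c ↦ (X₁ c.divNat ×ˢ X₂ c.modNat, Y₁ c.divNat ×ˢ Y₂ c.modNat)`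
in `G₁ × G₂` is again a ladder (so class number, co-volume and host size all multiply: the merit of
a finite alphabet of ladders is super-multiplicative).

Design (explicit / elementary).  Everything is reduced to one explicit monotonicity fact about the
mixed-radix numeral `(d, m) ↦ r₂ * d + m` and to the two coordinate projections of `G₁ × G₂`; no
decision procedure is invoked and no normal form of the index order is computed:

1. `le_of_divNat_le_of_modNat_le` — `q.divNat ≤ p.divNat` and `q.modNat ≤ p.modNat` give `q ≤ p`,
   since `(q : ℕ) = r₂ * (q / r₂) + q % r₂ ≤ r₂ * (p / r₂) + p % r₂ = p`
   (`Nat.div_add_mod`, `Nat.mul_le_mul_left`, `Nat.add_le_add`);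
2. `divNat_lt_or_modNat_lt_of_lt` — contrapositive: `p < q` forces a strict increase in SOME digit;
3. the equations in `G₁ × G₂` are read off coordinatewise: the coordinates of `(x - x') + (y - y')`
   and of `y - x` are the corresponding expressions in the coordinates, definitionally (`show`).

The separation clause uses the first ladder when the quotient digit increases and the second ladder
when the remainder digit increases; since the diagonal class `c` is arbitrary in `hL₁`/`hL₂`, no
equality of quotient digits is needed in the second case.
-/

-- single-conjunct summit: the mandated namespace repeats `MatrixMultiplication` (summit = sub-problem).
set_option linter.dupNamespace false

namespace Summit.MatrixMultiplication.MatrixMultiplication.Theorems.PrimeTwoFamilies.LadderLexProdElementaryK22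

/-- **Digitwise monotonicity of the mixed-radix order.**  For `p q : Fin (r₁ * r₂)`, if both digits
of `q` are at most those of `p` (`q.divNat ≤ p.divNat` and `q.modNat ≤ p.modNat`) then `q ≤ p`,
because `(q : ℕ) = r₂ * (q / r₂) + q % r₂ ≤ r₂ * (p / r₂) + p % r₂ = p`. -/
theorem le_of_divNat_le_of_modNat_le {r₁ r₂ : ℕ} {p q : Fin (r₁ * r₂)}
    (hd : q.divNat ≤ p.divNat) (hm : q.modNat ≤ p.modNat) : q ≤ p := by
  rw [Fin.le_def, Fin.coe_divNat, Fin.coe_divNat] at hd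
  rw [Fin.le_def, Fin.coe_modNat, Fin.coe_modNat] at hm
  rw [Fin.le_def, ← Nat.div_add_mod (q : ℕ) r₂, ← Nat.div_add_mod (p : ℕ) r₂]
  exact Nat.add_le_add (Nat.mul_le_mul_left r₂ hd) hm

/-- **Under `p < q` some digit increases strictly**: for `p q : Fin (r₁ * r₂)` with `p < q`, either
`p.divNat < q.divNat` or `p.modNat < q.modNat` (the contrapositive of
`le_of_divNat_le_of_modNat_le`). -/
theorem divNat_lt_or_modNat_lt_of_lt {r₁ r₂ : ℕ} {p q : Fin (r₁ * r₂)} (hpq : p < q) :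
    p.divNat < q.divNat ∨ p.modNat < q.modNat := by
  by_contra h
  rw [not_or, not_lt, not_lt] at h
  exact absurd hpq (not_lt.2 (le_of_divNat_le_of_modNat_le h.1 h.2))

/-- **Lexicographic products of ladders are ladders** (registered stub `isLadder_lexProd`, explicit /
elementary proof).  If `(X₁ c, Y₁ c)_{c < r₁}` is a ladder in `G₁` (each class direct, `hW₁`;
one-directionally separated, `hL₁`) and `(X₂ c, Y₂ c)_{c < r₂}` is a ladder in `G₂` (`hW₂`, `hL₂`),
then the family indexed by `c : Fin (r₁ * r₂)` with classes `X₁ c.divNat ×ˢ X₂ c.modNat` and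
`Y₁ c.divNat ×ˢ Y₂ c.modNat` in `G₁ × G₂` is a ladder: every class is direct (first conjunct: apply
`hW₁`, `hW₂` to the two coordinates of the equation and reassemble with `Prod.ext`) and the family is
one-directionally separated (second conjunct: by `divNat_lt_or_modNat_lt_of_lt`, `p < q` raises the
quotient digit — separate with `hL₁` in the first coordinate — or the remainder digit — separate
with `hL₂` in the second coordinate). -/
theorem isLadder_lexProd {G₁ G₂ : Type*} [AddCommGroup G₁] [AddCommGroup G₂] {r₁ r₂ : ℕ}
    (X₁ Y₁ : Fin r₁ → Finset G₁) (X₂ Y₂ : Fin r₂ → Finset G₂)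
    (hW₁ : ∀ c : Fin r₁, ∀ x ∈ X₁ c, ∀ x' ∈ X₁ c, ∀ y ∈ Y₁ c, ∀ y' ∈ Y₁ c,
      (x - x') + (y - y') = 0 → x = x' ∧ y = y')
    (hL₁ : ∀ c p q : Fin r₁, p < q → ∀ x ∈ X₁ c, ∀ y ∈ Y₁ c, ∀ x' ∈ X₁ p, ∀ y' ∈ Y₁ q,
      y - x ≠ y' - x')
    (hW₂ : ∀ c : Fin r₂, ∀ x ∈ X₂ c, ∀ x' ∈ X₂ c, ∀ y ∈ Y₂ c, ∀ y' ∈ Y₂ c,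
      (x - x') + (y - y') = 0 → x = x' ∧ y = y')
    (hL₂ : ∀ c p q : Fin r₂, p < q → ∀ x ∈ X₂ c, ∀ y ∈ Y₂ c, ∀ x' ∈ X₂ p, ∀ y' ∈ Y₂ q,
      y - x ≠ y' - x') :
    (∀ c : Fin (r₁ * r₂), ∀ x ∈ X₁ c.divNat ×ˢ X₂ c.modNat, ∀ x' ∈ X₁ c.divNat ×ˢ X₂ c.modNat,
        ∀ y ∈ Y₁ c.divNat ×ˢ Y₂ c.modNat, ∀ y' ∈ Y₁ c.divNat ×ˢ Y₂ c.modNat,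
        (x - x') + (y - y') = 0 → x = x' ∧ y = y') ∧
    (∀ c p q : Fin (r₁ * r₂), p < q →
        ∀ x ∈ X₁ c.divNat ×ˢ X₂ c.modNat, ∀ y ∈ Y₁ c.divNat ×ˢ Y₂ c.modNat,
        ∀ x' ∈ X₁ p.divNat ×ˢ X₂ p.modNat, ∀ y' ∈ Y₁ q.divNat ×ˢ Y₂ q.modNat, y - x ≠ y' - x') := by
  constructor
  · -- directness, coordinate by coordinate
    intro c x hx x' hx' y hy y' hy' h
    have h₁ : (x.1 - x'.1) + (y.1 - y'.1) = 0 := by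
      show ((x - x') + (y - y')).1 = (0 : G₁ × G₂).1
      rw [h]
    have h₂ : (x.2 - x'.2) + (y.2 - y'.2) = 0 := by
      show ((x - x') + (y - y')).2 = (0 : G₁ × G₂).2
      rw [h]
    have k₁ := hW₁ c.divNat x.1 (Finset.mem_product.1 hx).1 x'.1 (Finset.mem_product.1 hx').1
      y.1 (Finset.mem_product.1 hy).1 y'.1 (Finset.mem_product.1 hy').1 h₁
    have k₂ := hW₂ c.modNat x.2 (Finset.mem_product.1 hx).2 x'.2 (Finset.mem_product.1 hx').2
      y.2 (Finset.mem_product.1 hy).2 y'.2 (Finset.mem_product.1 hy').2 h₂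
    exact ⟨Prod.ext k₁.1 k₂.1, Prod.ext k₁.2 k₂.2⟩
  · -- one-directional separation: some digit of the class index increases strictly under `p < q`
    intro c p q hpq x hx y hy x' hx' y' hy' h
    rcases divNat_lt_or_modNat_lt_of_lt hpq with hlt | hlt
    · refine hL₁ c.divNat p.divNat q.divNat hlt x.1 (Finset.mem_product.1 hx).1
        y.1 (Finset.mem_product.1 hy).1 x'.1 (Finset.mem_product.1 hx').1
        y'.1 (Finset.mem_product.1 hy').1 ?_
      show (y - x).1 = (y' - x').1
      rw [h]
    · refine hL₂ c.modNat p.modNat q.modNat hlt x.2 (Finset.mem_product.1 hx).2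
        y.2 (Finset.mem_product.1 hy).2 x'.2 (Finset.mem_product.1 hx').2
        y'.2 (Finset.mem_product.1 hy').2 ?_
      show (y - x).2 = (y' - x').2
      rw [h]

end Summit.MatrixMultiplication.MatrixMultiplication.Theorems.PrimeTwoFamilies.LadderLexProdElementaryK22
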